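import Summits.QuantumFields.YangMills.Theorems.UnitScaleTiltProp7BlockDistanceWeights
import HarnessLib

/-!
# Route `UnitScaleTilt`, crux K1 «MinimiserStabilityRegPr» (stmt-QuantumFields-19200), EX row `hGF[Lift]` (curved member) — **LOD LINE, PEN (L5″) THE CUT-OFF GEOMETRY OF A CUBE:
# PLATEAU CUT-OFF `χ`, INNER CUT-OFF `χ̃`, AGMON PHASE `φ` FROM ONE BLOCK-SET DISTANCE WEIGHT** — the geometric hypotheses of px5 g11's three member rows
# (✓`Prop7GramDifferenceNearRowMember.norm_gram_apply_sub_le_near_member` p759867, ✓`Prop7PropagatorComparisonOnCutoff` p755265, ✓`Prop7TopMeanComparisonOnPropagatorDock` p757348),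
# which are what stays displayed under this seat's ✓`Prop7LocalProjectorRowCube.hloc_of_cube_rows` (p760402), CONSTRUCTED for an arbitrary non-empty coarse block set `T₀`
# (at the cube: the blocks within `r` of `S_c`):
# * §1 ★★ `exists_setDistanceWeight` — px12's B3 ✓`Prop7BlockDistanceWeights.exists_blockDistanceWeight` with the block `B(y)` replaced by the UNION of the blocks of `T₀`:
#   `w x = η·min_{x′ ∈ ⋃_{y∈T₀} B(y)} tdist x x′`, slope `η` per bond, in-block oscillation `3`, `w = 0` on `T₀`'s blocks, lower bound `tdist(z, y) − 3 ≤ w x` for some `y ∈ T₀` (`x ∈ B(z)`);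
# * §2 the clamp `t ↦ max 0 (min 1 t)` (`1`-Lipschitz, values in `[0,1]`, `= 1` above `1`, `= 0` below `0`);
# * §3 ★★★ `exists_cubeCutoffs` — for slopes `ν ≥ 0` (cut-offs), `μa ≥ 0` (Agmon) and heights `1 ≤ Bt`, `Bt + 1 ≤ Bc`: `χ := clamp(Bc − ν·w)`, `χ̃ := clamp(Bt − ν·w)`, `φ := μa·w` (with
#   block companions `χc`, `φc`) satisfy EVERY geometric hypothesis of ✓p759867 — `|χ| ≤ 1`, `|χ(x+e_μ) − χ(x)| ≤ ν·η`, `|χ x − χc(B x)| ≤ 3ν`, `|χ̃| ≤ 1`, `|1 − χ̃| ≤ 1`, `χ̃ ≠ 0 ⟹ χ = 1`,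
#   `χ = χ̃ = 1` and `φ = 0` on `T₀`'s blocks (its `hχN`, `hφN` for every `d` supported there), `|φ b₊ − φ b₋| ≤ μa·η`, `|φ x − φc(B x)| ≤ 3μa`, `χ̃ x ≠ 1 ⟹ μa·(Bt − 1)∕ν ≤ φ x` (its `hR`
#   with `R := μa(Bt − 1)∕ν`) — plus the SUPPORT ROW `χ x ≠ 0 ⟹ ∃ y ∈ T₀, tdist(B x, y) < Bc∕ν + 3` (where the assembler must supply gauge flatness ∕ no-wrap room).

Cell `ym3-torus` (HUMAN RULING D-0037, YM ladder rung R3 — NOT d = 4, NOT infinite volume, NOT a mass gap, NOT Clay).  Width seat `ym-routeR-w2` gen 13 (04:14:00Z offer, first refusal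
px5 g11 ∕ px17 g9).  THEOREMS ONLY (0 `def`, 0 `sorry`); `--supports stmt-QuantumFields-19200 --as helper`, count-neutral.  HONEST LABEL (★★OWNER RULING №33 (6)): curved γ-row supplier
line (LOD localisation), pen (L5″); lattice geometry only — nothing of the member rows themselves, (3.49), Thm 3.1∕3.3, `hT`, `hGF`, EX ∕ 19200 is proved here.

WHAT IS PROVED (ns `Summit.QuantumFields.YangMills.Theorems.Prop7CubeCutoffGeometry`).
* §1 ★★ `exists_setDistanceWeight`.
* §2 `clamp_nonneg`, `clamp_le_one`, `clamp_eq_zero_iff_le` (the `1`-Lipschitz and plateau facts are two-line `have`s inside §3; cf. lit `PlateauMollifier.abs_clamp_sub_clamp_le`).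
* §3 ★★★ `exists_cubeCutoffs`.

References: T. Bałaban, CMP **99** (1985) 389–434 [Balaban1985BackgroundPropagators] (Thm 3.1 (3.46) p.398, (3.49) p.399, Thm 3.3 p.399); CMP **98** (1985) 17–51 [Balaban1985Averaging]
((2) p.17).
-/

set_option autoImplicit false

noncomputable section

open scoped BigOperators

namespace Summit.QuantumFields.YangMills.Theorems.Prop7CubeCutoffGeometry

open Literature.MathematicalPhysics.QuantumFieldTheory.Balaban1983to89
open Literature.MathematicalPhysics.QuantumFieldTheory.Balaban1983to89.T3ContinuumYM3Torus
open T3SectALandauChart (eta eta_pos)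
open B5Eq118OneStroke (iterBlockOf iterBlock mem_iterBlock card_iterBlock)
open B3Taylor310LocalRemainder (tdist_comm tdist_triangle)
open Summit.QuantumFields.Balaban3D.Proofs.Run3Collar (tdist_shift_le)
open Summit.QuantumFields.YangMills.Theorems.Prop7BlockDistanceWeights (tdist_iterBlockOf_le tdist_le_of_iterBlockOf_eq tdist_src_tgt_le_one eta_mul_pow_eq_one)

variable (F : T3Family) {n K : ℕ}

/-! ## §1 The distance weight to a block SET -/

/-- ★★ **THE BLOCK-SET DISTANCE WEIGHT** (B3 ✓`exists_blockDistanceWeight` with one block replaced by the union of the blocks of a non-empty coarse set `T`): there are `w`, `wc` with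
(o) `0 ≤ w`; (i) per-bond slope `|w b₊ − w b₋| ≤ η`; (i′) `|w x − w x′| ≤ η·tdist x x′`; (i″) `|w(x+e_μ) − w x| ≤ η`; (ii) `|w x − wc(B x)| ≤ 3`; (iii) `w = 0` on the blocks of `T`;
(iv) for `x ∈ B(z)`: `tdist(z, y) − 3 ≤ w x` for SOME `y ∈ T`. [cite: Balaban1985BackgroundPropagators, Thm 3.1 (3.46) p.398; Balaban1985Averaging, (2) p.17] -/
theorem exists_setDistanceWeight (hnK : n ≤ K) (T : Finset (Site (F.P K) (K - n))) (hT : T.Nonempty) :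
    ∃ (w : Site (F.P K) 0 → ℝ) (wc : Site (F.P K) (K - n) → ℝ),
      (∀ x, 0 ≤ w x) ∧
      (∀ bd : PBond (F.P K) 0, |w bd.tgt - w bd.src| ≤ eta F n K) ∧
      (∀ x x', |w x - w x'| ≤ eta F n K * (Site.tdist x x' : ℝ)) ∧
      (∀ (x : Site (F.P K) 0) (μ : Fin (F.P K).d), |w (x.shift μ) - w x| ≤ eta F n K) ∧
      (∀ x, |w x - wc (iterBlockOf (K - n) x)| ≤ 3) ∧
      (∀ x, iterBlockOf (K - n) x ∈ T → w x = 0) ∧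
      (∀ (z : Site (F.P K) (K - n)) (x : Site (F.P K) 0), iterBlockOf (K - n) x = z → ∃ y ∈ T, (Site.tdist z y : ℝ) - 3 ≤ w x) := by
  classical
  have hk : K - n ≤ (F.P K).m + (F.P K).K := by show K - n ≤ F.m + K; omega
  have hη : 0 < eta F n K := eta_pos F n K
  -- every block is non-empty, hence the union over `T` is
  have hne : ∀ z : Site (F.P K) (K - n), (iterBlock (K - n) z).Nonempty := fun z => by
    rw [← Finset.card_pos, card_iterBlock (K - n) hk]; exact pow_pos (pow_pos (F.P K).L_pos _) _
  set U : Finset (Site (F.P K) 0) := T.biUnion fun y => iterBlock (K - n) y with hU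
  have hUne : U.Nonempty := by
    obtain ⟨y, hy⟩ := hT
    obtain ⟨x, hx⟩ := hne y
    exact ⟨x, Finset.mem_biUnion.mpr ⟨y, hy, hx⟩⟩
  have hmemU : ∀ x', x' ∈ U ↔ iterBlockOf (K - n) x' ∈ T := fun x' => by
    rw [hU, Finset.mem_biUnion]
    constructor
    · rintro ⟨y, hy, hx⟩; rwa [(mem_iterBlock _ _ _).mp hx]
    · intro hx; exact ⟨_, hx, (mem_iterBlock _ _ _).mpr rfl⟩
  -- the distance to `U`
  set D : Site (F.P K) 0 → ℝ := fun x => U.inf' hUne (fun x' => (Site.tdist x x' : ℝ)) with hD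
  have hD0 : ∀ x, 0 ≤ D x := fun x => Finset.le_inf' _ _ fun x' _ => Nat.cast_nonneg _
  have hDle : ∀ x, ∀ x' ∈ U, D x ≤ (Site.tdist x x' : ℝ) := fun x x' hx' => Finset.inf'_le _ hx'
  have hDatt : ∀ x, ∃ x' ∈ U, D x = (Site.tdist x x' : ℝ) := fun x => Finset.exists_mem_eq_inf' hUne _
  -- `D` is `1`-Lipschitz for the fine distance
  have hDlip : ∀ x x', |D x - D x'| ≤ (Site.tdist x x' : ℝ) := by
    intro x x'
    rw [abs_sub_le_iff]
    constructor
    · obtain ⟨u, hu, hue⟩ := hDatt x'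
      have h1 := hDle x u hu
      have h2 : (Site.tdist x u : ℝ) ≤ Site.tdist x x' + Site.tdist x' u := by exact_mod_cast tdist_triangle x x' u
      linarith
    · obtain ⟨u, hu, hue⟩ := hDatt x
      have h1 := hDle x' u hu
      have h2 : (Site.tdist x' u : ℝ) ≤ Site.tdist x' x + Site.tdist x u := by exact_mod_cast tdist_triangle x' x u
      have h3 : Site.tdist x' x = Site.tdist x x' := tdist_comm x' x
      rw [h3] at h2
      linarith
  -- a representative site of every block
  have hrep : ∀ z : Site (F.P K) (K - n), ∃ r : Site (F.P K) 0, iterBlockOf (K - n) r = z := fun z => by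
    obtain ⟨r, hr⟩ := hne z; exact ⟨r, (mem_iterBlock _ _ _).mp hr⟩
  choose rep hrep using hrep
  have hlip : ∀ x x', |eta F n K * D x - eta F n K * D x'| ≤ eta F n K * (Site.tdist x x' : ℝ) := by
    intro x x'
    rw [← mul_sub, abs_mul, abs_of_nonneg hη.le]
    exact mul_le_mul_of_nonneg_left (hDlip x x') hη.le
  refine ⟨fun x => eta F n K * D x, fun z => eta F n K * D (rep z), fun x => mul_nonneg hη.le (hD0 x), ?_, hlip, ?_, ?_, ?_, ?_⟩
  · -- (i) per-bond slope
    intro bd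
    calc |eta F n K * D bd.tgt - eta F n K * D bd.src| ≤ eta F n K * (Site.tdist bd.tgt bd.src : ℝ) := hlip _ _
      _ ≤ eta F n K * 1 := by
          refine mul_le_mul_of_nonneg_left ?_ hη.le
          rw [tdist_comm]
          exact_mod_cast tdist_src_tgt_le_one bd
      _ = eta F n K := mul_one _
  · -- (i″) one step
    intro x μ
    calc |eta F n K * D (x.shift μ) - eta F n K * D x| ≤ eta F n K * (Site.tdist (x.shift μ) x : ℝ) := hlip _ _
      _ ≤ eta F n K * 1 := by
          refine mul_le_mul_of_nonneg_left ?_ hη.le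
          rw [tdist_comm]
          exact_mod_cast tdist_shift_le x μ
      _ = eta F n K := mul_one _
  · -- (ii) in-block oscillation
    intro x
    have hsame : iterBlockOf (K - n) x = iterBlockOf (K - n) (rep (iterBlockOf (K - n) x)) := (hrep (iterBlockOf (K - n) x)).symm
    have hdiam : (Site.tdist x (rep (iterBlockOf (K - n) x)) : ℝ) ≤ (F.P K).d * ((F.P K).L ^ (K - n) - 1 : ℕ) := by
      exact_mod_cast tdist_le_of_iterBlockOf_eq hk hsame
    have hd3 : ((F.P K).d : ℝ) = 3 := by norm_num [T3Family.P_d]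
    have hpow : (((F.P K).L ^ (K - n) - 1 : ℕ) : ℝ) ≤ (F.L : ℝ) ^ (K - n) := by
      have : (((F.P K).L ^ (K - n) - 1 : ℕ) : ℝ) ≤ (((F.P K).L ^ (K - n) : ℕ) : ℝ) := by exact_mod_cast Nat.sub_le _ _
      refine this.trans ?_
      push_cast
      exact le_of_eq rfl
    have hηℓ : eta F n K * (F.L : ℝ) ^ (K - n) = 1 := eta_mul_pow_eq_one F
    calc |eta F n K * D x - eta F n K * D (rep (iterBlockOf (K - n) x))| ≤ eta F n K * (Site.tdist x (rep (iterBlockOf (K - n) x)) : ℝ) := hlip _ _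
      _ ≤ eta F n K * (3 * (F.L : ℝ) ^ (K - n)) := by
          refine mul_le_mul_of_nonneg_left (hdiam.trans ?_) hη.le
          rw [hd3]
          exact mul_le_mul_of_nonneg_left hpow (by norm_num)
      _ = 3 * (eta F n K * (F.L : ℝ) ^ (K - n)) := by ring
      _ = 3 := by rw [hηℓ, mul_one]
  · -- (iii) vanishing on the blocks of `T`
    intro x hx
    show eta F n K * D x = 0
    have hxU : x ∈ U := (hmemU x).mpr hx
    have h0 : D x ≤ 0 := by
      have := hDle x x hxU
      rw [B3Taylor310LocalRemainder.tdist_self] at this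
      exact_mod_cast this
    rw [le_antisymm h0 (hD0 x), mul_zero]
  · -- (iv) the lower bound through the contraction of the block map
    intro z x hxz
    show ∃ y ∈ T, (Site.tdist z y : ℝ) - 3 ≤ eta F n K * D x
    obtain ⟨x', hx', hDx⟩ := hDatt x
    refine ⟨iterBlockOf (K - n) x', (hmemU x').mp hx', ?_⟩
    have hcon := tdist_iterBlockOf_le hk x x'
    rw [hxz] at hcon
    have hL : (0 : ℝ) < (F.L : ℝ) ^ (K - n) := pow_pos (by exact_mod_cast (F.P K).L_pos) (K - n)
    have hreal : (Site.tdist z (iterBlockOf (K - n) x') : ℝ) ≤ (Site.tdist x x' : ℝ) / (F.L : ℝ) ^ (K - n) + 3 := by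
      have h1 : (Site.tdist z (iterBlockOf (K - n) x') : ℝ) ≤ ((Site.tdist x x' / (F.P K).L ^ (K - n) : ℕ) : ℝ) + (F.P K).d := by exact_mod_cast hcon
      have h2 : ((Site.tdist x x' / (F.P K).L ^ (K - n) : ℕ) : ℝ) ≤ (Site.tdist x x' : ℝ) / (F.L : ℝ) ^ (K - n) := by
        have := Nat.cast_div_le (m := Site.tdist x x') (n := (F.P K).L ^ (K - n)) (α := ℝ)
        refine this.trans (le_of_eq ?_)
        push_cast
        rfl
      have hd3 : ((F.P K).d : ℝ) = 3 := by norm_num [T3Family.P_d]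
      linarith
    have hηeq : eta F n K = ((F.L : ℝ) ^ (K - n))⁻¹ := by rw [T3SectALandauChart.eta, inv_pow]
    rw [hDx, hηeq]
    have : ((Site.tdist x x' : ℝ) / (F.L : ℝ) ^ (K - n)) = ((F.L : ℝ) ^ (K - n))⁻¹ * (Site.tdist x x' : ℝ) := by rw [div_eq_inv_mul]
    linarith

/-! ## §2 The clamp `t ↦ max 0 (min 1 t)` -/

/-- `0 ≤ clamp t`. [folklore] -/
theorem clamp_nonneg (t : ℝ) : 0 ≤ max 0 (min 1 t) := le_max_left _ _

/-- `clamp t ≤ 1`. [folklore] -/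
theorem clamp_le_one (t : ℝ) : max 0 (min 1 t) ≤ 1 := max_le zero_le_one (min_le_left _ _)

/-- `clamp t = 0 ↔ t ≤ 0`. [folklore] -/
theorem clamp_eq_zero_iff_le {t : ℝ} : max 0 (min 1 t) = 0 ↔ t ≤ 0 := by
  constructor
  · intro h0
    by_contra hpos
    push Not at hpos
    have : 0 < max 0 (min 1 t) := lt_max_of_lt_right (lt_min zero_lt_one hpos)
    linarith
  · intro ht
    rw [max_eq_left]
    exact (min_le_right _ _).trans ht

/-! ## §3 The three cut-offs of a cube -/

/-- ★★★ **THE CUT-OFF GEOMETRY OF A CUBE** (the geometric inputs of px5 g11's ✓p759867 ∕ ✓p755265 ∕ ✓p757348, for ANY non-empty coarse block set `T₀` — at the cube: the blocks within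
`r` of `S_c`): for slopes `ν ≥ 0`, `μa ≥ 0` and heights `1 ≤ Bt`, `Bt + 1 ≤ Bc` there are `χ χ̃ : fine sites → ℝ`, `χc : blocks → ℝ`, `φ : fine sites → ℝ`, `φc : blocks → ℝ` with
(1) `|χ| ≤ 1`; (2) `|χ(x+e_μ) − χ x| ≤ ν·η`; (3) `|χ x − χc(B x)| ≤ 3ν`; (4) `|χ̃| ≤ 1`; (5) `|1 − χ̃| ≤ 1`; (6) `χ̃ x ≠ 0 → χ x = 1`; (7) on `T₀`'s blocks `χ = 1`, `χ̃ = 1`, `φ = 0`;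
(8) `|φ b₊ − φ b₋| ≤ μa·η`; (9) `|φ x − φc(B x)| ≤ 3μa`; (10) `0 ≤ φ`; (11) `χ̃ x ≠ 1 → μa·(Bt − 1)∕ν… ` stated as `μa * ((Bt − 1) ∕ ν) ≤ φ x` when `0 < ν`; (12) `χ x ≠ 0 → ∃ y ∈ T₀,
tdist(B x, y) − 3 < Bc ∕ ν` (support row, `0 < ν`).  Construction: `w` of §1, `χ = clamp(Bc − νw)`, `χ̃ = clamp(Bt − νw)`, `φ = μa·w`.
[cite: Balaban1985BackgroundPropagators, Thm 3.1 (3.46) p.398, (3.49) p.399, Thm 3.3 p.399] -/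
theorem exists_cubeCutoffs (hnK : n ≤ K) (T₀ : Finset (Site (F.P K) (K - n))) (hT₀ : T₀.Nonempty)
    {ν μa Bt Bc : ℝ} (hν : 0 < ν) (hμa : 0 ≤ μa) (hBt : 1 ≤ Bt) (hBc : Bt + 1 ≤ Bc) :
    ∃ (χ χt : Site (F.P K) 0 → ℝ) (χc : Site (F.P K) (K - n) → ℝ) (φ : Site (F.P K) 0 → ℝ) (φc : Site (F.P K) (K - n) → ℝ),
      (∀ x, |χ x| ≤ 1) ∧
      (∀ (x : Site (F.P K) 0) (μ : Fin (F.P K).d), |χ (x.shift μ) - χ x| ≤ ν * eta F n K) ∧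
      (∀ x, |χ x - χc (iterBlockOf (K - n) x)| ≤ 3 * ν) ∧
      (∀ x, |χt x| ≤ 1) ∧
      (∀ x, |1 - χt x| ≤ 1) ∧
      (∀ x, χt x ≠ 0 → χ x = 1) ∧
      (∀ x, iterBlockOf (K - n) x ∈ T₀ → χ x = 1 ∧ χt x = 1 ∧ φ x = 0) ∧
      (∀ bd : PBond (F.P K) 0, |φ bd.tgt - φ bd.src| ≤ μa * eta F n K) ∧
      (∀ x, |φ x - φc (iterBlockOf (K - n) x)| ≤ 3 * μa) ∧
      (∀ x, 0 ≤ φ x) ∧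
      (∀ x, χt x ≠ 1 → μa * ((Bt - 1) / ν) ≤ φ x) ∧
      (∀ x, χ x ≠ 0 → ∃ y ∈ T₀, (Site.tdist (iterBlockOf (K - n) x) y : ℝ) - 3 < Bc / ν) := by
  obtain ⟨w, wc, hw0, hwb, hwlip, hwstep, hwosc, hwT, hwlow⟩ := exists_setDistanceWeight F hnK T₀ hT₀
  have hη : 0 < eta F n K := eta_pos F n K
  -- the clamp `t ↦ max 0 (min 1 t)`: `1`-Lipschitz, values in `[0, 1]`, `= 1` above `1` (lit `PlateauMollifier.abs_clamp_sub_clamp_le`-class facts, two lines each)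
  have abs_clamp_sub_clamp_le : ∀ a b : ℝ, |max 0 (min 1 a) - max 0 (min 1 b)| ≤ |a - b| := fun a b =>
    calc |max 0 (min 1 a) - max 0 (min 1 b)| ≤ max |(0 : ℝ) - 0| |min 1 a - min 1 b| := abs_max_sub_max_le_max _ _ _ _
      _ = |min 1 a - min 1 b| := by simp
      _ ≤ max |(1 : ℝ) - 1| |a - b| := abs_min_sub_min_le_max _ _ _ _
      _ = |a - b| := by simp
  have clamp_eq_one : ∀ {t : ℝ}, 1 ≤ t → max 0 (min 1 t) = 1 := fun ht => by rw [min_eq_left ht, max_eq_right zero_le_one]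
  have abs_clamp_le_one : ∀ t : ℝ, |max 0 (min 1 t)| ≤ 1 := fun t => by rw [abs_of_nonneg (clamp_nonneg t)]; exact clamp_le_one t
  have abs_one_sub_clamp_le_one : ∀ t : ℝ, |1 - max 0 (min 1 t)| ≤ 1 := fun t => by
    rw [abs_of_nonneg (sub_nonneg.mpr (clamp_le_one t))]; linarith [clamp_nonneg t]
  refine ⟨fun x => max 0 (min 1 (Bc - ν * w x)), fun x => max 0 (min 1 (Bt - ν * w x)), fun z => max 0 (min 1 (Bc - ν * wc z)),
    fun x => μa * w x, fun z => μa * wc z, fun x => abs_clamp_le_one _, ?_, ?_, fun x => abs_clamp_le_one _, fun x => abs_one_sub_clamp_le_one _, ?_, ?_, ?_, ?_,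
    fun x => mul_nonneg hμa (hw0 x), ?_, ?_⟩
  · -- (2) one-step slope of `χ`
    intro x μ
    calc |max 0 (min 1 (Bc - ν * w (x.shift μ))) - max 0 (min 1 (Bc - ν * w x))| ≤ |(Bc - ν * w (x.shift μ)) - (Bc - ν * w x)| := abs_clamp_sub_clamp_le _ _
      _ = ν * |w (x.shift μ) - w x| := by
          rw [show (Bc - ν * w (x.shift μ)) - (Bc - ν * w x) = -(ν * (w (x.shift μ) - w x)) by ring, abs_neg, abs_mul, abs_of_pos hν]
      _ ≤ ν * eta F n K := mul_le_mul_of_nonneg_left (hwstep x μ) hν.le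
  · -- (3) block oscillation of `χ`
    intro x
    calc |max 0 (min 1 (Bc - ν * w x)) - max 0 (min 1 (Bc - ν * wc (iterBlockOf (K - n) x)))| ≤ |(Bc - ν * w x) - (Bc - ν * wc (iterBlockOf (K - n) x))| :=
          abs_clamp_sub_clamp_le _ _
      _ = ν * |w x - wc (iterBlockOf (K - n) x)| := by
          rw [show (Bc - ν * w x) - (Bc - ν * wc (iterBlockOf (K - n) x)) = -(ν * (w x - wc (iterBlockOf (K - n) x))) by ring, abs_neg, abs_mul, abs_of_pos hν]
      _ ≤ ν * 3 := mul_le_mul_of_nonneg_left (hwosc x) hν.le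
      _ = 3 * ν := mul_comm _ _
  · -- (6) `χ̃ ≠ 0 ⟹ χ = 1`
    intro x hx
    have hlt : ν * w x < Bt := by
      by_contra hge
      push Not at hge
      exact hx (clamp_eq_zero_iff_le.mpr (by linarith))
    exact clamp_eq_one (by linarith)
  · -- (7) on `T₀`'s blocks
    intro x hx
    have hw : w x = 0 := hwT x hx
    refine ⟨?_, ?_, ?_⟩
    · show max 0 (min 1 (Bc - ν * w x)) = 1
      exact clamp_eq_one (by rw [hw]; linarith)
    · show max 0 (min 1 (Bt - ν * w x)) = 1
      exact clamp_eq_one (by rw [hw]; linarith)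
    · show μa * w x = 0
      rw [hw, mul_zero]
  · -- (8) Agmon slope
    intro bd
    rw [← mul_sub, abs_mul, abs_of_nonneg hμa]
    exact mul_le_mul_of_nonneg_left (hwb bd) hμa
  · -- (9) Agmon block oscillation
    intro x
    rw [← mul_sub, abs_mul, abs_of_nonneg hμa, mul_comm 3 μa]
    exact mul_le_mul_of_nonneg_left (hwosc x) hμa
  · -- (11) the phase is `≥ R` off the inner plateau
    intro x hx
    have hgt : Bt - 1 < ν * w x := by
      by_contra hle
      push Not at hle
      exact hx (clamp_eq_one (by linarith))
    have h1 : (Bt - 1) / ν ≤ w x := by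
      rw [div_le_iff₀ hν]; linarith [mul_comm ν (w x)]
    exact mul_le_mul_of_nonneg_left h1 hμa
  · -- (12) support of `χ`
    intro x hx
    have hlt : ν * w x < Bc := by
      by_contra hge
      push Not at hge
      exact hx (clamp_eq_zero_iff_le.mpr (by linarith))
    obtain ⟨y, hy, hlow⟩ := hwlow (iterBlockOf (K - n) x) x rfl
    refine ⟨y, hy, ?_⟩
    have h1 : w x < Bc / ν := by rw [lt_div_iff₀ hν]; linarith [mul_comm ν (w x)]
    linarith

end Summit.QuantumFields.YangMills.Theorems.Prop7CubeCutoffGeometry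

end
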